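/-
Copyright (c) 2026 the pub-hodgecm-mathlib formalisation cell (harness21).  Prover seat hodgecm-mathlib-LH4-p07 (g11) (Track A «FOUR-FRAME» free hand routed by the
CHAIR VALVE to L1; LEAD F0P6-plan (g14) BATCH #108 (2) «(K1a-♮) `K2LiuKindOneSingularTermPackage` statement-first»; line lead K2E5-p16 (g8) WORD #6 (2) (Q1) «=»:
«antecedent = the (K1a-3) LOCAL REGULARITY PACKAGE BY VALUE»), Track B «K2-LIT», #184♮ = hLiu418 = stmt-HodgeConjecture-24832.
THE FIRST THREE K1-a♮ LETTERS `(Eac, hEad, hEac)` FROM BY-VALUE SINGULAR EULER FACES — the K1 twin of ★ p862134 `K2LiuBigCellContinuationOfFacesSum` §1–§2 (KIND 0),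
with the K1 scalar of record (★ p862613) in place of `b^S∕a^S`, a finite shell-polynomial factor, and the WITNESS EQUATION exported (LH4-p11 (g10) flag (F-V) «value opacity»).
-/
import Summits.HodgeConjecture.HodgeConjecture.Theorems.K2LiuKindOneLettersOfRecord          -- ★ p862409 (F0P2-p11): the socket's vocabulary (`whittakerDelta`, `skewMatrices`, `gramR`, `HA`)
import Summits.HodgeConjecture.HodgeConjecture.Theorems.K2LiuKindOneSingularScalarGL1        -- ★ p862613 (R90-C14-p02, (K1a-4) FILE 1): `exists_differentiableOn_sub_half_mul_scalarK1_cm`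
import Summits.HodgeConjecture.HodgeConjecture.Theorems.K2LiuBigCellContinuationPointLetters   -- ★ (K2Liu-p13 lineage): `differentiableOn_re_pos_of_forall_isQRationalRegularAt`
import HarnessLib

/-!
# Crux `HLiu418`, socket #41 KIND 1 a♮ — (K1a-♮)′ `K2LiuKindOneSingularContinuationOfFaces`: THE CONTINUED SINGULAR TERM `Eac` WITH `hEad`, `hEac` AND ITS WITNESS
# EQUATION, FROM BY-VALUE EULER FACES `(∫β)⁻¹·W_S(f_s)(h) = [Σ_i A_i ∏_{v∈TF}(c_v N_{i,v})] · sc^T(s) · ∏_{v∈D} P_v` ON `{n∕2 < re s}` (rank-one `S`, every `h`)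

Cell `hodgecm-mathlib`, crux item hLiu418 = `stmt-HodgeConjecture-24832`, route `HCCMUnconditional`; squad K2 ∕ K2Liu, LEAD F0P6-plan (g14), line lead K2E5-p16 (g8),
K1 desk F0P2-p11 (g2).  THEOREMS ONLY (no `def`, no instance, no notation, no named-fact hypothesis, no `sorry`, default heartbeats); lane
`--supports stmt-HodgeConjecture-24832 --as helper` (count-neutral).

THE POINT (line lead census `CENSUS-K1a-GK` §3 (K1a-4)∕(K1a-♮), this seat's census `CENSUS-K1a-SingularTermPackage` §1, WORD #6 (Q1) «=»).  The singular (rank-one)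
term of socket #41's KIND 1 a♮ is, on ★ G1's domain `{1 < re s}` = `{n∕2 < re s}` (`n = 2`), an EULER PRODUCT read at the corner index: a finite SUM of pure-tensor FACES
`Σ_{i∈I} A_i(s) ∏_{v∈TF}(c_v(s)·N_{i,v}(s))` (arch blocks `A_i` and bad-place scalars `c_v` holomorphic on `{0 < re}`, normalised local values `N_{i,v}` `q_v`-rational and REGULAR at
EVERY `s₀` of the half-plane — (K1a-3): the twisted last stage has NO pole, ★ p862716 ∕ K2E3-p29 ∕ LH4-p10), times the K1 SCALAR OF RECORD `sc^T(s) = ζ^T(2s) ∕ (ζ^T(2s+1)·L^T(2s+2, ε))`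
(★ p862613; its tail collapse ★ p862812), times a FINITE product of shell polynomials `P_v` (`v ∈ D`, ★ p862724 (K1a-2)).  GIVEN THAT IDENTITY BY VALUE per rank-one `S` and every
`h` (the surface the END FILE pays from ★ G1 + ★ (K1a-1) + ★ (K1a-2) + (K1a-3)), THIS FILE delivers the first three letters of the TOP's K1-a♮ block (★ p862515 :181–:186):
`Eac := [faces]·G^T·∏ P_v` on rank-one `S` (`0` off rank one), holomorphic on `{0 < re}` in `s` for EVERY `(S, h)` (`hEad`), and the PIN `(s − ½)·((∫β)⁻¹ • W_S(f_s)(h)) = Eac S s h`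
on `{n∕2 < re s}` (`hEac`) — where `(s − ½)·sc^T = G^T` is ★ FILE 1's pole-cleared continuation — AND, per LH4-p11 (g10)'s flag (F-V), the WITNESS EQUATIONS (`Eac =` the explicit
product on rank one, `= 0` off rank one, with the `G` used and its defining identity) so that the (L-dec)∕(L-supp) letters `hdeca`∕`hsuppa` and the value at `s = ½` can later be READ
OFF the faces (no value opacity).
* §1 **`exists_continuation_of_singularFaces`** — generic (`X` any index type, predicate `R`, scalars `sc, G` by value): holomorphy + pin + witness equations.
* §2 **`exists_kindOne_singularContinuation_of_faces`** — at the socket frame of ★ p862515 ∕ ★ p862409: `X := (rank-one skew Hermitian indices) × H(𝔸)`, `sc := sc^{T(S,h)}` the K1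
  scalar of record at a finite set `T(S,h)` of places, `G` from ★ `exists_differentiableOn_sub_half_mul_scalarK1_cm` (chosen per `(S,h)`), `n = 2` from the doubling datum `e`;
  output `(Eac, hEad, hEac)` in the TOP's BYTES + the witness block.
NOT HERE (by design, separate letters of the twelve): `τa hτa Na hdeca Ca κa hCa hκa hsuppa` — they need the faces' growth∕support letters ((K1a-3) (b)(c), desk (Q2)(Q3)).
HONEST LABEL.  Count-neutral helper; the faces identity is a HYPOTHESIS here (its producer is the K1-a♮ END FILE); nothing here closes a socket: `HC_CM` is proved only modulo
the 7 printed citations (2 remaining named inputs: hLiu418 = `stmt-HodgeConjecture-24832`, h413 = `stmt-HodgeConjecture-24833`) until rung 0 closes.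

## References
* [Tan1999] V. Tan, *Poles of Siegel Eisenstein series on U(n,n)*, Canad. J. Math. 51 (1999) 164–175: §3, §4 Prop. 4.8 (the singular coefficients and their poles).
* [KudlaRallis1994] S. Kudla, S. Rallis, *A regularized Siegel–Weil formula: the first term identity*, Ann. of Math. 140 (1994): §2 (2.10)–(2.12).
* [KudlaSweet1997] S. Kudla, W. J. Sweet, *Degenerate principal series representations for U(n,n)*, Israel J. Math. 98 (1997): §1 (local factors rational in `q^{-s}`).
* [MoeglinWaldspurger1995] C. Mœglin, J.-L. Waldspurger, *Spectral Decomposition and Eisenstein Series* (1995): II.1.7, IV.1.9.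
-/

set_option autoImplicit false
set_option linter.dupNamespace false -- the mandated namespace repeats `HodgeConjecture.HodgeConjecture`

noncomputable section

open scoped Matrix Topology ENNReal NNReal BigOperators ComplexConjugate
open NumberField IsDedekindDomain MeasureTheory Filter
open Literature.NumberTheory.Automorphic Literature.NumberTheory.LFunctions Literature.NumberTheory.GaloisRepresentations
open Literature.NumberTheory.GelbartRogawski1991 Literature.NumberTheory.GelbartRogawski1991.GRConstruction
open Literature.NumberTheory.K2Lit.SiegelDoubled Literature.MeasureTheory.Group
open Literature.NumberTheory.Automorphic.IdeleClassGroup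
open Summit.HodgeConjecture.HodgeConjecture.Cruxes.HLiu418.K2LiuQRationalDefs (IsQRationalRegularAt)
open Summit.HodgeConjecture.HodgeConjecture.Cruxes.HLiu418.K2LiuBigCellContinuationPointLetters (differentiableOn_re_pos_of_forall_isQRationalRegularAt)
open Summit.HodgeConjecture.HodgeConjecture.Cruxes.HLiu418.K2LiuKindOneSingularScalarGL1 (exists_differentiableOn_sub_half_mul_scalarK1_cm)

namespace Summit.HodgeConjecture.HodgeConjecture.Cruxes.HLiu418.K2LiuKindOneSingularContinuationOfFaces

open K2LiuSiegelUnipotentFourierDefs K2LiuSiegelUnipotentCharacters K2LiuUnipotentCoveringWeight K2LiuSiegelFourierCoeffDelta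

/-! ## §1 Generic: faces + pole-cleared scalar ⟹ the continued term, its pin, and its witness equations -/

/-- **THE CONTINUED SINGULAR TERM FROM ITS FACES (generic).**  Index type `X` (later: pairs `(S, h)`), a predicate `R` (later: «`S` is rank one»), the normalised term
`W : ℂ → X → ℂ`, per `x` a scalar `sc x` with a pole-cleared continuation `G x` (`(s − ½)·sc x s = G x s` on `½ < re s`, `G x` holomorphic on `{0 < re}`), pure-tensor faces
`A x i`, `c x v` holomorphic on `{0 < re}` and `N x i v` `q_v`-rational regular at EVERY `s₀` with `0 < re s₀` (`i ∈ I x`, `v ∈ TF x`), a finite family `Pf x v` (`v ∈ D x`) holomorphic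
on `{0 < re}`, and the FACES IDENTITY on `c₀ < re s` (`½ ≤ c₀`) for every `x` with `R x`.  THEN `Eac s x := [Σ_{i∈I x} A x i s ∏_{v∈TF x}(c x v s·N x i v s)]·G x s·∏_{v∈D x} Pf x v s`
(and `0` off `R`) is holomorphic on `{0 < re}` in `s` for EVERY `x`, satisfies `(s − ½)·W s x = Eac s x` on `c₀ < re s` for `R x`, and the two witness equations hold by `rfl`.
[cite: Tan1999, §3; §4 Prop. 4.8] [cite: KudlaSweet1997, §1] -/
theorem exists_continuation_of_singularFaces {X ι ι' κ : Type*} (R : X → Prop) (W : ℂ → X → ℂ) (c₀ : ℝ) (hc₀ : 1 / 2 ≤ c₀)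
    (sc G : X → ℂ → ℂ) (hG : ∀ x, DifferentiableOn ℂ (G x) {s : ℂ | 0 < s.re})
    (hsc : ∀ x (s : ℂ), 1 / 2 < s.re → (s - 1 / 2) * sc x s = G x s)
    (I : X → Finset ι') (TF : X → Finset ι) (q : ι → ℕ) (hq : ∀ x, ∀ v ∈ TF x, q v ≠ 0)
    (A : X → ι' → ℂ → ℂ) (hA : ∀ x, ∀ i ∈ I x, DifferentiableOn ℂ (A x i) {s : ℂ | 0 < s.re})
    (c : X → ι → ℂ → ℂ) (hc : ∀ x, ∀ v ∈ TF x, DifferentiableOn ℂ (c x v) {s : ℂ | 0 < s.re})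
    (N : X → ι' → ι → ℂ → ℂ) (hN : ∀ x, ∀ i ∈ I x, ∀ v ∈ TF x, ∀ s₀ : ℂ, 0 < s₀.re → IsQRationalRegularAt (q v) s₀ (N x i v))
    (D : X → Finset κ) (Pf : X → κ → ℂ → ℂ) (hPf : ∀ x, ∀ v ∈ D x, DifferentiableOn ℂ (Pf x v) {s : ℂ | 0 < s.re})
    (hface : ∀ x, R x → ∀ s : ℂ, c₀ < s.re →
      W s x = (∑ i ∈ I x, A x i s * ∏ v ∈ TF x, (c x v s * N x i v s)) * sc x s * ∏ v ∈ D x, Pf x v s) :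
    ∃ Eac : ℂ → X → ℂ,
      (∀ x, DifferentiableOn ℂ (fun s => Eac s x) {s : ℂ | 0 < s.re}) ∧
      (∀ x, R x → ∀ s : ℂ, c₀ < s.re → (s - 1 / 2) * W s x = Eac s x) ∧
      (∀ x (s : ℂ), R x → Eac s x = (∑ i ∈ I x, A x i s * ∏ v ∈ TF x, (c x v s * N x i v s)) * G x s * ∏ v ∈ D x, Pf x v s) ∧
      (∀ x (s : ℂ), ¬ R x → Eac s x = 0) := by
  classical
  -- the faces sum is holomorphic on `{0 < re}` (K0's point assembly, ★ `differentiableOn_re_pos_of_forall_isQRationalRegularAt` for the `N`'s)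
  have hF : ∀ x, DifferentiableOn ℂ (fun s => ∑ i ∈ I x, A x i s * ∏ v ∈ TF x, (c x v s * N x i v s)) {s : ℂ | 0 < s.re} := fun x =>
    DifferentiableOn.fun_sum fun i hi => (hA x i hi).mul (DifferentiableOn.fun_finsetProd fun v hv =>
      (hc x v hv).mul (differentiableOn_re_pos_of_forall_isQRationalRegularAt (hq x v hv) (hN x i hi v hv)))
  refine ⟨fun s x => if R x then (∑ i ∈ I x, A x i s * ∏ v ∈ TF x, (c x v s * N x i v s)) * G x s * ∏ v ∈ D x, Pf x v s else 0,
    fun x => ?_, fun x hx s hs => ?_, fun x s hx => if_pos hx, fun x s hx => if_neg hx⟩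
  · by_cases hx : R x
    · simp only [if_pos hx]
      exact ((hF x).mul (hG x)).mul (DifferentiableOn.fun_finsetProd (hPf x))
    · simp only [if_neg hx]
      exact differentiableOn_const 0
  · have hs' : 1 / 2 < s.re := lt_of_le_of_lt hc₀ hs
    simp only [if_pos hx]
    rw [hface x hx s hs, ← hsc x s hs']
    ring

/-! ## §2 At the socket frame: the first three K1-a♮ letters of ★ p862515's block from by-value singular faces -/

section Socket

variable (L : Type) [Field L] [NumberField L] [IsCMField L]

open Classical in
/-- **(K1a-♮)′ `(Eac, hEad, hEac)` OF SOCKET #41's K1-a♮ BLOCK FROM BY-VALUE SINGULAR EULER FACES, WITH THE WITNESS BLOCK.**  At the TOP's frame (CM field `L`, doubling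
datum `(e, dV, dW)` with `e : Fin 2 × Fin 1 ≃ Fin n`, family `f`, carrier `(νN, β)`): suppose that for every rank-one skew-Hermitian index `S` (`S ≠ 0`, `det S = 0`) and every
`h ∈ H(𝔸)` we are GIVEN a finite set of places `T S h` of `L⁺`, pure-tensor faces `(I, TF, q, A, c, N)` with `A S h i`, `c S h v` holomorphic on `{0 < re}` and `N S h i v`
`q_v`-rational regular at every `s₀` with `0 < re s₀` ((K1a-3)'s «no pole» shape), a finite family of shell polynomials `Pf S h v` (`v ∈ D S h`) holomorphic on `{0 < re}`, and the
FACES IDENTITY on `{n∕2 < re s}`: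
`(∫β)⁻¹ • W_S(νN)(f_s)(h) = [Σ_{i∈I} A_i(s) ∏_{v∈TF}(c_v(s) N_{i,v}(s))] · ζ_{L⁺}^T(2s)∕(ζ_{L⁺}^T(2s+1)·L^T(2s+2, ε_{L∕L⁺})) · ∏_{v∈D} Pf_v(s)`.
THEN there is `Eac : Skew → ℂ → H(𝔸) → ℂ` with `hEad` (holomorphic on `{0 < re}` in `s`, every `S, x`) and `hEac` (the PIN `(s − ½)·((∫β)⁻¹ • W_S(f_s)(h)) = Eac S s h` on `{n∕2 < re s}`,
rank-one `S`) — ★ p862515 :182–:186 VERBATIM — together with the WITNESS BLOCK: the pole-cleared K1 scalars `G S h` used (★ `exists_differentiableOn_sub_half_mul_scalarK1_cm` at `T S h`,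
`(s − ½)·sc^{T S h}(s) = G S h s` on `½ < re s`, holomorphic on `{0 < re}`), `Eac S s h = [faces]·G S h s·∏ Pf` on rank-one `S`, and `Eac S s h = 0` off rank one.
[cite: Tan1999, §4 Prop. 4.8] [cite: KudlaRallis1994, §2 (2.10)–(2.12)] [cite: KudlaSweet1997, §1] [cite: MoeglinWaldspurger1995, IV.1.9] -/
theorem exists_kindOne_singularContinuation_of_faces {n : ℕ} (e : Fin 2 × Fin 1 ≃ Fin n)
    (dV : Fin 2 → L) (hdV : ∀ i, IsCMField.complexConj L (dV i) = dV i)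
    (dW : Fin 1 → L) (hdW : ∀ i, IsCMField.complexConj L (dW i) = dW i)
    (f : ℂ → HA L e dV hdV dW hdW → ℂ)
    [MeasurableSpace (unipDelta L e dV hdV dW hdW)] (νN : Measure (unipDelta L e dV hdV dW hdW)) (β : unipDelta L e dV hdV dW hdW → ℝ≥0∞)
    {ι ι' : Type*}
    (T : skewMatrices ((IsCMField.complexConj L : L ≃ₐ[Fp L] L) : L →+* L) ((gramR L e dV hdV dW hdW).map (algebraMap (Fp L) L)) → HA L e dV hdV dW hdW →
      Set (HeightOneSpectrum (𝓞 ↥(maximalRealSubfield L))))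
    (hT : ∀ S h, (T S h).Finite)
    (I : skewMatrices ((IsCMField.complexConj L : L ≃ₐ[Fp L] L) : L →+* L) ((gramR L e dV hdV dW hdW).map (algebraMap (Fp L) L)) → HA L e dV hdV dW hdW → Finset ι')
    (TF : skewMatrices ((IsCMField.complexConj L : L ≃ₐ[Fp L] L) : L →+* L) ((gramR L e dV hdV dW hdW).map (algebraMap (Fp L) L)) → HA L e dV hdV dW hdW → Finset ι)
    (q : ι → ℕ) (hq : ∀ S h, ∀ v ∈ TF S h, q v ≠ 0)
    (A : skewMatrices ((IsCMField.complexConj L : L ≃ₐ[Fp L] L) : L →+* L) ((gramR L e dV hdV dW hdW).map (algebraMap (Fp L) L)) → HA L e dV hdV dW hdW → ι' → ℂ → ℂ)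
    (hA : ∀ S h, ∀ i ∈ I S h, DifferentiableOn ℂ (A S h i) {s : ℂ | 0 < s.re})
    (c : skewMatrices ((IsCMField.complexConj L : L ≃ₐ[Fp L] L) : L →+* L) ((gramR L e dV hdV dW hdW).map (algebraMap (Fp L) L)) → HA L e dV hdV dW hdW → ι → ℂ → ℂ)
    (hc : ∀ S h, ∀ v ∈ TF S h, DifferentiableOn ℂ (c S h v) {s : ℂ | 0 < s.re})
    (N : skewMatrices ((IsCMField.complexConj L : L ≃ₐ[Fp L] L) : L →+* L) ((gramR L e dV hdV dW hdW).map (algebraMap (Fp L) L)) → HA L e dV hdV dW hdW → ι' → ι → ℂ → ℂ)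
    (hN : ∀ S h, ∀ i ∈ I S h, ∀ v ∈ TF S h, ∀ s₀ : ℂ, 0 < s₀.re → IsQRationalRegularAt (q v) s₀ (N S h i v))
    (D : skewMatrices ((IsCMField.complexConj L : L ≃ₐ[Fp L] L) : L →+* L) ((gramR L e dV hdV dW hdW).map (algebraMap (Fp L) L)) → HA L e dV hdV dW hdW →
      Finset (HeightOneSpectrum (𝓞 ↥(maximalRealSubfield L))))
    (Pf : skewMatrices ((IsCMField.complexConj L : L ≃ₐ[Fp L] L) : L →+* L) ((gramR L e dV hdV dW hdW).map (algebraMap (Fp L) L)) → HA L e dV hdV dW hdW →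
      HeightOneSpectrum (𝓞 ↥(maximalRealSubfield L)) → ℂ → ℂ)
    (hPf : ∀ S h, ∀ v ∈ D S h, DifferentiableOn ℂ (Pf S h v) {s : ℂ | 0 < s.re})
    (hface : ∀ S : skewMatrices ((IsCMField.complexConj L : L ≃ₐ[Fp L] L) : L →+* L) ((gramR L e dV hdV dW hdW).map (algebraMap (Fp L) L)),
      (S : Matrix (Fin n) (Fin n) L) ≠ 0 → (S : Matrix (Fin n) (Fin n) L).det = 0 → ∀ (h : HA L e dV hdV dW hdW) (s : ℂ), (n : ℝ) / 2 < s.re →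
        ((∫⁻ u, β u ∂νN).toReal⁻¹ : ℝ) • whittakerDelta L e dV hdV dW hdW νN (S : Matrix (Fin n) (Fin n) L) (f s) h =
          (∑ i ∈ I S h, A S h i s * ∏ v ∈ TF S h, (c S h v s * N S h i v s)) *
            (partialStandardL (T S h) (fun _ => {1}) (2 * s) /
              (partialStandardL (T S h) (fun _ => {1}) (2 * s + 1) *
                partialStandardL (T S h) (fun v => {(quadraticHeckeCharCM L).valueAtUniformizer v}) (2 * s + 2))) *
            ∏ v ∈ D S h, Pf S h v s) :
    ∃ (Eac : skewMatrices ((IsCMField.complexConj L : L ≃ₐ[Fp L] L) : L →+* L) ((gramR L e dV hdV dW hdW).map (algebraMap (Fp L) L)) → ℂ → HA L e dV hdV dW hdW → ℂ),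
      (∀ S x, DifferentiableOn ℂ (fun s => Eac S s x) {s : ℂ | 0 < s.re}) ∧
      (∀ S : skewMatrices ((IsCMField.complexConj L : L ≃ₐ[Fp L] L) : L →+* L) ((gramR L e dV hdV dW hdW).map (algebraMap (Fp L) L)),
        (S : Matrix (Fin n) (Fin n) L) ≠ 0 → (S : Matrix (Fin n) (Fin n) L).det = 0 → ∀ (s : ℂ) (h : HA L e dV hdV dW hdW), (n : ℝ) / 2 < s.re →
          (s - 1 / 2) * (((∫⁻ u, β u ∂νN).toReal⁻¹ : ℝ) • whittakerDelta L e dV hdV dW hdW νN (S : Matrix (Fin n) (Fin n) L) (f s) h) = Eac S s h) ∧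
      ∃ (G : skewMatrices ((IsCMField.complexConj L : L ≃ₐ[Fp L] L) : L →+* L) ((gramR L e dV hdV dW hdW).map (algebraMap (Fp L) L)) → HA L e dV hdV dW hdW → ℂ → ℂ),
        (∀ S h, DifferentiableOn ℂ (G S h) {s : ℂ | 0 < s.re}) ∧
        (∀ S h (s : ℂ), 1 / 2 < s.re →
          (s - 1 / 2) *
              (partialStandardL (T S h) (fun _ => {1}) (2 * s) /
                (partialStandardL (T S h) (fun _ => {1}) (2 * s + 1) *
                  partialStandardL (T S h) (fun v => {(quadraticHeckeCharCM L).valueAtUniformizer v}) (2 * s + 2))) = G S h s) ∧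
        (∀ (S : skewMatrices ((IsCMField.complexConj L : L ≃ₐ[Fp L] L) : L →+* L) ((gramR L e dV hdV dW hdW).map (algebraMap (Fp L) L))) (h : HA L e dV hdV dW hdW) (s : ℂ),
          (S : Matrix (Fin n) (Fin n) L) ≠ 0 → (S : Matrix (Fin n) (Fin n) L).det = 0 →
            Eac S s h = (∑ i ∈ I S h, A S h i s * ∏ v ∈ TF S h, (c S h v s * N S h i v s)) * G S h s * ∏ v ∈ D S h, Pf S h v s) ∧
        (∀ (S : skewMatrices ((IsCMField.complexConj L : L ≃ₐ[Fp L] L) : L →+* L) ((gramR L e dV hdV dW hdW).map (algebraMap (Fp L) L))) (h : HA L e dV hdV dW hdW) (s : ℂ),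
          ¬ ((S : Matrix (Fin n) (Fin n) L) ≠ 0 ∧ (S : Matrix (Fin n) (Fin n) L).det = 0) → Eac S s h = 0) := by
  -- `n = 2` from the doubling datum, so `n ∕ 2 = 1 ≥ ½`
  have hn : n = 2 := by simpa using (Fintype.card_congr e).symm
  have hc₀ : (1 / 2 : ℝ) ≤ (n : ℝ) / 2 := by rw [hn]; norm_num
  -- the pole-cleared K1 scalars, chosen per `(S, h)` (★ FILE 1 at the finite set `T S h`)
  choose G hG hGsc using fun p : skewMatrices ((IsCMField.complexConj L : L ≃ₐ[Fp L] L) : L →+* L) ((gramR L e dV hdV dW hdW).map (algebraMap (Fp L) L)) ×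
      HA L e dV hdV dW hdW => exists_differentiableOn_sub_half_mul_scalarK1_cm L (hT p.1 p.2)
  -- §1 at `X := Skew × H(𝔸)`, `R := rank one`, `W s (S,h) := (∫β)⁻¹ • W_S(f_s)(h)`
  obtain ⟨E, hEd, hEpin, hEw, hE0⟩ := exists_continuation_of_singularFaces
    (X := skewMatrices ((IsCMField.complexConj L : L ≃ₐ[Fp L] L) : L →+* L) ((gramR L e dV hdV dW hdW).map (algebraMap (Fp L) L)) × HA L e dV hdV dW hdW)
    (fun p => (p.1 : Matrix (Fin n) (Fin n) L) ≠ 0 ∧ (p.1 : Matrix (Fin n) (Fin n) L).det = 0)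
    (fun s p => ((∫⁻ u, β u ∂νN).toReal⁻¹ : ℝ) • whittakerDelta L e dV hdV dW hdW νN (p.1 : Matrix (Fin n) (Fin n) L) (f s) p.2) ((n : ℝ) / 2) hc₀
    (fun p s => partialStandardL (T p.1 p.2) (fun _ => {1}) (2 * s) /
      (partialStandardL (T p.1 p.2) (fun _ => {1}) (2 * s + 1) * partialStandardL (T p.1 p.2) (fun v => {(quadraticHeckeCharCM L).valueAtUniformizer v}) (2 * s + 2)))
    G hG (fun p s hs => hGsc p s hs)
    (fun p => I p.1 p.2) (fun p => TF p.1 p.2) q (fun p => hq p.1 p.2) (fun p => A p.1 p.2) (fun p => hA p.1 p.2) (fun p => c p.1 p.2) (fun p => hc p.1 p.2)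
    (fun p => N p.1 p.2) (fun p => hN p.1 p.2) (fun p => D p.1 p.2) (fun p => Pf p.1 p.2) (fun p => hPf p.1 p.2)
    (fun p hp s hs => hface p.1 hp.1 hp.2 p.2 s hs)
  refine ⟨fun S s h => E s (S, h), fun S x => hEd (S, x), fun S hS0 hSd s h hs => hEpin (S, h) ⟨hS0, hSd⟩ s hs,
    fun S h => G (S, h), fun S h => hG (S, h), fun S h s hs => hGsc (S, h) s hs, fun S h s hS0 hSd => hEw (S, h) s ⟨hS0, hSd⟩, fun S h s hS => hE0 (S, h) s hS⟩

end Socket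

end Summit.HodgeConjecture.HodgeConjecture.Cruxes.HLiu418.K2LiuKindOneSingularContinuationOfFaces

end
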